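import Literature.Analysis.Hypoelliptic.EnergyInequality
import HarnessLib

/-!
# Kohn's iteration, I: the commutator lemmas and the `X_j`-step

Analysis/Hypoelliptic support file, eleventh piece of the Fourier-side toolkit serving the
discharge of `Literature.Analysis.Distribution.Hormander1967_thm11` by Kohn's method
(M. Taylor, *Pseudodifferential Operators* (1981), Ch. XV §1, (1.29)–(1.34)).

For a Hörmander operator `P = ∑ X_j² + X₀ + c` on the Fourier side (`HData`) and a bracket
field `F`, Kohn's subelliptic statement is
`S(F, ε) : ‖F u‖_{ε-1} ≤ C (‖P u‖₀ + ‖u‖₀)` for all `u ∈ Nice` (`HData.KohnS`). This file proves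

* the weighted self-pairing `⟨G, Λ^{2s} G⟩ = ‖G‖_s²`;
* **Lemma A** (move a real field across the pairing, Taylor (1.31)):
  `|⟨X G, T u⟩| ≤ ‖G‖_σ · C (‖X u‖₀ + ‖u‖₀)` when `ord T ≤ σ`, `lev T ≤ 1`;
* **Lemma B** (move a bracket field across, Taylor after (1.31)):
  `|⟨F' H, T u⟩| ≤ ‖H‖₀ · C (‖F' u‖_σ + ‖u‖₀)` when `ord T ≤ σ ≤ 0`;
* **Lemma C** (the expansion `[P, T] = ∑_j T_j X_j + T₀`, Taylor (1.36)/(1.38)):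
  `|⟨G, [P, T] u⟩| ≤ ‖G‖_{ord T} · C (∑_j ‖X_j u‖₀ + ‖u‖₀)` for plain `T`;
* **the `X_j`-step** (Taylor (1.32)): `S(F', ε')` implies `S([X_j, F'], ε'/2)`, and the base
  case `S(X_j, 1)`.

## References

* M. E. Taylor, *Pseudodifferential Operators* (1981), Ch. XV §1, (1.29)–(1.34).
-/

noncomputable section

open MeasureTheory Set Filter Function
open scoped ENNReal NNReal Topology ComplexConjugate InnerProductSpace BigOperators

namespace Literature.Analysis.Hypoelliptic

variable {V : Type*} [NormedAddCommGroup V] [InnerProductSpace ℝ V] [FiniteDimensional ℝ V]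
  [MeasurableSpace V] [BorelSpace V]

/-! ### Real-norm bounds for symbolic operators -/

namespace Sym

/-- **Boundedness in real norms**: `‖s u‖_{t'} ≤ C ‖u‖_t` for `t' ≤ t - ord s`, `u ∈ Nice`.
[folklore] -/
theorem Cert.rn_le {s : Sym V} (hs : Cert s) {t t' : ℝ} (ht : t' ≤ t - ord s) :
    ∃ C : ℝ, 0 ≤ C ∧ ∀ u : V → ℂ, Nice u → rn t' (apply s u) ≤ C * rn t u :=
  hs.bound_toReal' ht

/-- Transport of real-norm bounds along `≈`. [folklore] -/
theorem Equiv.rn_le {s s' : Sym V} (h : s ≈ s') (hs' : Cert s') {t t' : ℝ} (ht : t' ≤ t - ord s') :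
    ∃ C : ℝ, 0 ≤ C ∧ ∀ u : V → ℂ, Nice u → rn t' (apply s u) ≤ C * rn t u :=
  h.bound_toReal' hs' ht

/-- The pairing of a symbolic sum on the right is the sum of the pairings. [folklore] -/
theorem pairing_sum_apply_right {l : List (Sym V)} (hl : ∀ s ∈ l, Cert s) {F G : V → ℂ}
    (hF : Nice F) (hG : Nice G) :
    pairing G (apply (sum l) F) = (l.map fun s => pairing G (apply s F)).sum := by
  induction l with
  | nil => simp [pairing]
  | cons s l ih =>
    have hl' : ∀ t ∈ l, Cert t := fun t ht => hl t (List.mem_cons_of_mem _ ht)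
    rw [sum_cons s l F hF, apply_add, List.map_cons, List.sum_cons,
      pairing_add_right (hG.inH 0) (by simpa using ((hl s List.mem_cons_self).nice_apply hF).inH 0)
        (by simpa using ((cert_sum hl').nice_apply hF).inH 0), ih hl']

end Sym

/-- **`⟨G, Λ^{2s} G⟩ = ‖G‖_s²`.** [folklore] -/
theorem pairing_bessel_right {G : V → ℂ} (hG : Nice G) (s : ℝ) :
    pairing G ((Sym.bessel (2 * s)).apply G) = ((rn s G ^ 2 : ℝ) : ℂ) := by
  set H : V → ℂ := fun ξ => (bw s ξ : ℂ) * G ξ with hH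
  have hHn : Nice H := (mulBound_bw s).nice_mul hG
  have h1 : pairing G ((Sym.bessel (2 * s)).apply G) = pairing H H := by
    rw [Sym.apply_bessel, hH, pairing_mul_left]
    unfold pairing
    refine integral_congr_ae (Eventually.of_forall fun ξ => ?_)
    simp only [Sym.bwC_apply, Complex.conj_ofReal, map_mul]
    rw [show (bw (2 * s) ξ : ℂ) = (bw s ξ : ℂ) * (bw s ξ : ℂ) by
      rw [← Complex.ofReal_mul, ← bw_add]; ring_nf]
    ring
  rw [h1, pairing_self (hHn.inH 0)]
  congr 2
  unfold rn
  rw [hH, wnorm_bw_mul, zero_add]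

/-- **`⟨Λ^{2s} G, G⟩ = ‖G‖_s²`.** [folklore] -/
theorem pairing_bessel_left {G : V → ℂ} (hG : Nice G) (s : ℝ) :
    pairing ((Sym.bessel (2 * s)).apply G) G = ((rn s G ^ 2 : ℝ) : ℂ) := by
  rw [pairing_comm, pairing_bessel_right hG s, Complex.conj_ofReal]

/-- `‖F u‖_{ε-1}² = Re ⟨F u, Λ^{2ε-2} (F u)⟩`, the starting identity (1.30). [folklore] -/
theorem rn_sq_eq_re_pairing {G : V → ℂ} (hG : Nice G) (ε : ℝ) :
    rn (ε - 1) G ^ 2 = (pairing G ((Sym.bessel (2 * ε - 2)).apply G)).re := by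
  rw [show 2 * ε - 2 = 2 * (ε - 1) by ring, pairing_bessel_right hG, Complex.ofReal_re]

/-- Product bookkeeping: `a ≤ A`, `b ≤ c B` give `a b ≤ c A B`. [folklore] -/
theorem mul_bound {a b A B c : ℝ} (ha : a ≤ A) (hb : b ≤ c * B) (hb0 : 0 ≤ b) (hA : 0 ≤ A) :
    a * b ≤ c * A * B :=
  calc a * b ≤ A * (c * B) := mul_le_mul ha hb hb0 hA
    _ = c * A * B := by ring

/-- `y² ≤ C z²` with `y, z, C ≥ 0` gives `y ≤ √C z`. [folklore] -/
theorem le_sqrt_mul_of_sq_le {y z C : ℝ} (hy : 0 ≤ y) (hz : 0 ≤ z) (hC : 0 ≤ C)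
    (h : y ^ 2 ≤ C * z ^ 2) : y ≤ Real.sqrt C * z :=
  calc y = Real.sqrt (y ^ 2) := (Real.sqrt_sq hy).symm
    _ ≤ Real.sqrt (C * z ^ 2) := Real.sqrt_le_sqrt h
    _ = Real.sqrt C * z := by rw [Real.sqrt_mul hC, Real.sqrt_sq hz]

/-! ### Kohn's statement `S(F, ε)` -/

namespace HData

open Sym Field

variable (d : HData V)

/-- **Kohn's subelliptic statement** `S(F, ε)`: `‖F u‖_{ε-1} ≤ C (‖P u‖₀ + ‖u‖₀)` for all
`u ∈ Nice` (Taylor 1981, (1.29)). [folklore] -/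
def KohnS (F : Field V) (ε : ℝ) : Prop :=
  ∃ C : ℝ, 0 ≤ C ∧ ∀ u : V → ℂ, Nice u →
    rn (ε - 1) ((toSym F).apply u) ≤ C * (rn 0 (d.opP.apply u) + rn 0 u)

/-- `S(F, ε)` is monotone in `ε` (downwards). [folklore] -/
theorem KohnS.mono {F : Field V} {ε ε' : ℝ} (h : d.KohnS F ε) (hle : ε' ≤ ε) (hcF : CertF F) :
    d.KohnS F ε' := by
  obtain ⟨C, hC, hb⟩ := h
  exact ⟨C, hC, fun u hu => (rn_mono (by linarith) (hcF.cert_toSym.nice_apply hu)).trans (hb u hu)⟩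

/-! ### Lemma A: moving a real field across the pairing -/

/-- **Lemma A** (Taylor (1.31)): for a real certified nonempty field `X` and `T` of level
`≤ 1` with `ord T ≤ σ`:
`|⟨X G, T u⟩| ≤ ‖G‖_σ · C (‖X u‖₀ + ‖u‖₀)` for `G, u ∈ Nice`. [folklore] -/
theorem lemmaA {X : Field V} (hX : IsField X) (hcX : CertF X) (hr : IsReal X) (hne : X ≠ [])
    {T : Sym V} (hT : Cert T) (hlev : lev T ≤ 1) {σ : ℝ} (hσ : ord T ≤ σ) :
    ∃ C : ℝ, 0 ≤ C ∧ ∀ G u : V → ℂ, Nice G → Nice u →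
      ‖pairing ((toSym X).apply G) (T.apply u)‖ ≤
        rn σ G * (C * (rn 0 ((toSym X).apply u) + rn 0 u)) := by
  have hcXs := hcX.cert_toSym
  have hcd := hcX.cert_divF hX
  have hcf := hcX.fcomm_cert hX hT
  -- constants
  obtain ⟨C₁, hC₁, h₁⟩ := hT.rn_le (t := 0) (t' := -σ) (by linarith)
  obtain ⟨C₂, hC₂, h₂⟩ := hcf.rn_le (t := 0) (t' := -σ)
    (by have := ord_fcomm_le hX hne T; linarith)
  obtain ⟨C₃, hC₃, h₃⟩ := (show Cert (comp (divF X) T) from ⟨hcd, hT⟩).rn_le (t := 0) (t' := -σ)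
    (by have := hX.isCoef_divF.ord_eq; simp only [ord_comp]; linarith)
  refine ⟨C₁ + C₂ + C₃, by positivity, fun G u hG hu => ?_⟩
  have hTu : Nice (T.apply u) := hT.nice_apply hu
  have hXu : Nice ((toSym X).apply u) := hcXs.nice_apply hu
  -- `X (T u) = T (X u) + (fcomm X T) u`
  have hcomm := comm_fcomm hX hcX hlev hT u hu
  rw [apply_comm] at hcomm
  have hXTu : (toSym X).apply (T.apply u) =
      fun ξ => T.apply ((toSym X).apply u) ξ + (fcomm X T).apply u ξ := by
    ext ξ
    exact (sub_eq_iff_eq_add.1 (congrFun hcomm ξ)).trans (add_comm _ _)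
  -- integration by parts
  rw [pairing_real hX hcX hr hTu hG, hXTu,
    pairing_add_right (hG.inH σ) ((hT.nice_apply hXu).inH (-σ)) ((hcf.nice_apply hu).inH (-σ))]
  have b₁ := (norm_pairing_le_rn σ hG (hT.nice_apply hXu)).trans
    (mul_le_mul_of_nonneg_left (h₁ _ hXu) (rn_nonneg _ _))
  have b₂ := (norm_pairing_le_rn σ hG (hcf.nice_apply hu)).trans
    (mul_le_mul_of_nonneg_left (h₂ _ hu) (rn_nonneg _ _))
  have b₃ := (norm_pairing_le_rn σ hG ((show Cert (comp (divF X) T) from ⟨hcd, hT⟩).nice_apply hu)).trans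
    (mul_le_mul_of_nonneg_left (h₃ _ hu) (rn_nonneg _ _))
  rw [apply_comp] at b₃
  have hn := rn_nonneg σ G
  have hx := rn_nonneg 0 ((toSym X).apply u)
  have hun := rn_nonneg 0 u
  calc ‖-(pairing G (T.apply ((toSym X).apply u)) + pairing G ((fcomm X T).apply u)) -
        pairing G ((divF X).apply (T.apply u))‖
      ≤ ‖pairing G (T.apply ((toSym X).apply u))‖ + ‖pairing G ((fcomm X T).apply u)‖ +
          ‖pairing G ((divF X).apply (T.apply u))‖ := by
        refine (norm_sub_le _ _).trans (add_le_add ((norm_neg _).le.trans (norm_add_le _ _)) le_rfl)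
    _ ≤ rn σ G * (C₁ * rn 0 ((toSym X).apply u)) + rn σ G * (C₂ * rn 0 u) +
          rn σ G * (C₃ * rn 0 u) := add_le_add (add_le_add b₁ b₂) b₃
    _ ≤ rn σ G * ((C₁ + C₂ + C₃) * (rn 0 ((toSym X).apply u) + rn 0 u)) := by
        have h0 : 0 ≤ rn σ G * (C₁ * rn 0 u + (C₂ + C₃) * rn 0 ((toSym X).apply u)) := by
          positivity
        nlinarith [h0]

/-! ### Lemma B: moving a bracket field across the pairing -/

/-- **Lemma B** (Taylor, after (1.31)): for a real certified nonempty field `F'` and `T` of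
level `≤ 1` with `ord T ≤ σ ≤ 0`:
`|⟨F' H, T u⟩| ≤ ‖H‖₀ · C (‖F' u‖_σ + ‖u‖₀)` for `H, u ∈ Nice`. [folklore] -/
theorem lemmaB {F' : Field V} (hF : IsField F') (hcF : CertF F') (hr : IsReal F') (hne : F' ≠ [])
    {T : Sym V} (hT : Cert T) (hlev : lev T ≤ 1) {σ : ℝ} (hσ : ord T ≤ σ) (hσ0 : σ ≤ 0) :
    ∃ C : ℝ, 0 ≤ C ∧ ∀ H u : V → ℂ, Nice H → Nice u →
      ‖pairing ((toSym F').apply H) (T.apply u)‖ ≤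
        rn 0 H * (C * (rn σ ((toSym F').apply u) + rn 0 u)) := by
  have hcFs := hcF.cert_toSym
  have hcd := hcF.cert_divF hF
  have hcf := hcF.fcomm_cert hF hT
  obtain ⟨C₁, hC₁, h₁⟩ := hT.rn_le (t := σ) (t' := 0) (by linarith)
  obtain ⟨C₂, hC₂, h₂⟩ := hcf.rn_le (t := σ) (t' := 0)
    (by have := ord_fcomm_le hF hne T; linarith)
  obtain ⟨C₃, hC₃, h₃⟩ := (show Cert (comp (divF F') T) from ⟨hcd, hT⟩).rn_le (t := σ) (t' := 0)
    (by have := hF.isCoef_divF.ord_eq; simp only [ord_comp]; linarith)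
  refine ⟨C₁ + C₂ + C₃, by positivity, fun H u hH hu => ?_⟩
  have hTu : Nice (T.apply u) := hT.nice_apply hu
  have hFu : Nice ((toSym F').apply u) := hcFs.nice_apply hu
  have hcomm := comm_fcomm hF hcF hlev hT u hu
  rw [apply_comm] at hcomm
  have hFTu : (toSym F').apply (T.apply u) =
      fun ξ => T.apply ((toSym F').apply u) ξ + (fcomm F' T).apply u ξ := by
    ext ξ
    exact (sub_eq_iff_eq_add.1 (congrFun hcomm ξ)).trans (add_comm _ _)
  rw [pairing_real hF hcF hr hTu hH, hFTu,
    pairing_add_right (hH.inH 0) (by simpa using ((hT.nice_apply hFu).inH 0))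
      (by simpa using ((hcf.nice_apply hu).inH 0))]
  have e₁ : rn (-0) (T.apply ((toSym F').apply u)) ≤ C₁ * rn σ ((toSym F').apply u) := by
    rw [neg_zero]; exact h₁ _ hFu
  have e₂ : rn (-0) ((fcomm F' T).apply u) ≤ C₂ * rn 0 u := by
    rw [neg_zero]; exact (h₂ _ hu).trans (mul_le_mul_of_nonneg_left (rn_mono hσ0 hu) hC₂)
  have e₃ : rn (-0) ((divF F').apply (T.apply u)) ≤ C₃ * rn 0 u := by
    have h := h₃ _ hu
    rw [apply_comp] at h
    rw [neg_zero]; exact h.trans (mul_le_mul_of_nonneg_left (rn_mono hσ0 hu) hC₃)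
  have b₁ := (norm_pairing_le_rn 0 hH (hT.nice_apply hFu)).trans
    (mul_le_mul_of_nonneg_left e₁ (rn_nonneg _ _))
  have b₂ := (norm_pairing_le_rn 0 hH (hcf.nice_apply hu)).trans
    (mul_le_mul_of_nonneg_left e₂ (rn_nonneg _ _))
  have b₃ := (norm_pairing_le_rn 0 hH
    ((show Cert (comp (divF F') T) from ⟨hcd, hT⟩).nice_apply hu)).trans
    (mul_le_mul_of_nonneg_left e₃ (rn_nonneg _ _))
  have hn := rn_nonneg 0 H
  have hx := rn_nonneg σ ((toSym F').apply u)
  have hun := rn_nonneg 0 u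
  calc ‖-(pairing H (T.apply ((toSym F').apply u)) + pairing H ((fcomm F' T).apply u)) -
        pairing H ((divF F').apply (T.apply u))‖
      ≤ ‖pairing H (T.apply ((toSym F').apply u))‖ + ‖pairing H ((fcomm F' T).apply u)‖ +
          ‖pairing H ((divF F').apply (T.apply u))‖ := by
        refine (norm_sub_le _ _).trans (add_le_add ((norm_neg _).le.trans (norm_add_le _ _)) le_rfl)
    _ ≤ rn 0 H * (C₁ * rn σ ((toSym F').apply u)) + rn 0 H * (C₂ * rn 0 u) +
          rn 0 H * (C₃ * rn 0 u) := add_le_add (add_le_add b₁ b₂) b₃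
    _ ≤ rn 0 H * ((C₁ + C₂ + C₃) * (rn σ ((toSym F').apply u) + rn 0 u)) := by
        have h0 : 0 ≤ rn 0 H * (C₁ * rn 0 u + (C₂ + C₃) * rn σ ((toSym F').apply u)) := by
          positivity
        nlinarith [h0]

/-! ### Lemma C: the expansion of `[P, T]` -/

/-- The symbolic expansion of `[P, T]` for plain `T`:
`∑_j (2 (fcomm X_j T) X_j + fcomm X_j (fcomm X_j T)) + fcomm X₀ T + ccomm C T`. [folklore] -/
def commP (T : Sym V) : Sym V :=
  add (add (Sym.sum (List.ofFn fun j : Fin d.J =>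
    add (smul 2 (comp (fcomm (d.X j) T) (d.Xs j))) (fcomm (d.X j) (fcomm (d.X j) T))))
    (fcomm d.X0 T)) (ccomm d.C T)

omit [FiniteDimensional ℝ V] in
/-- `commP` is certified. [folklore] -/
theorem cert_commP {T : Sym V} (hT : Cert T) : Cert (d.commP T) := by
  refine ⟨⟨cert_sum fun s hs => ?_, (d.certF0.fcomm_cert d.isField0 hT)⟩,
    (d.certC.ccomm_cert d.isCoefC hT)⟩
  obtain ⟨j, rfl⟩ := List.mem_ofFn.1 hs
  have h1 := (d.certF j).fcomm_cert (d.isField j) hT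
  exact ⟨⟨h1, d.cert_Xs j⟩, (d.certF j).fcomm_cert (d.isField j) h1⟩

/-- `[X_j², T] ≈ 2 (fcomm X_j T) X_j + fcomm X_j (fcomm X_j T)` for plain `T`. [folklore] -/
theorem comm_sq (j : Fin d.J) {T : Sym V} (hT : Cert T) (hpl : Plain T) :
    Sym.comm (comp (d.Xs j) (d.Xs j)) T ≈
      add (smul 2 (comp (fcomm (d.X j) T) (d.Xs j))) (fcomm (d.X j) (fcomm (d.X j) T)) := by
  have hX := d.isField j
  have hcX := d.certF j
  have hcXs := d.cert_Xs j
  have hl0 : lev T ≤ 1 := by simp [hpl.lev_eq]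
  have hfc := comm_fcomm hX hcX hl0 hT
  have hcf := hcX.fcomm_cert hX hT
  have hl1 : lev (fcomm (d.X j) T) ≤ 1 := (lev_fcomm_le hX T).trans (by simp [hpl.lev_eq])
  have hfc2 := comm_fcomm hX hcX hl1 hcf
  -- `[X X, T] = X [X,T] + [X,T] X`, and `X fc = fc X + [X, fc]`
  refine (comp_comm hcXs hcXs hT).trans ?_
  refine ((hfc.comp_right (d.Xs j)).add (hfc.comp_left hcXs)).trans ?_
  -- `comp X fc ≈ add (comp fc X) (fcomm X fc)` from `comm X fc ≈ fcomm X fc`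
  have hXfc : comp (d.Xs j) (fcomm (d.X j) T) ≈
      add (comp (fcomm (d.X j) T) (d.Xs j)) (fcomm (d.X j) (fcomm (d.X j) T)) := by
    intro F hF
    have h := hfc2 F hF
    simp only [apply_comm] at h
    ext ξ
    have hξ := congrFun h ξ
    simp only [apply_comp, apply_add] at hξ ⊢
    unfold Xs at *
    linear_combination hξ
  refine (hXfc.add Sym.Equiv.rfl).trans ?_
  intro F _
  ext ξ
  simp only [apply_add, apply_smul, apply_comp]
  ring

/-- **`[P, T] ≈ commP T`** for plain certified `T`. [folklore] -/
theorem comm_opP {T : Sym V} (hT : Cert T) (hpl : Plain T) : Sym.comm d.opP T ≈ d.commP T := by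
  have hl0 : lev T ≤ 1 := by simp [hpl.lev_eq]
  unfold opP commP
  refine (comm_add_left ((cert_add_iff _ _).2 ⟨d.cert_sqSum, d.cert_X0s⟩) d.certC hT).trans ?_
  refine Sym.Equiv.add ?_ (d.isCoefC.comm_sym d.certC hl0 hT)
  refine (comm_add_left d.cert_sqSum d.cert_X0s hT).trans ?_
  refine Sym.Equiv.add ?_ (comm_fcomm d.isField0 d.certF0 hl0 hT)
  unfold sqSum
  refine (comm_sum_left (fun s hs => ?_) hT).trans ?_
  · obtain ⟨j, rfl⟩ := List.mem_ofFn.1 hs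
    exact ⟨d.cert_Xs j, d.cert_Xs j⟩
  rw [List.map_ofFn]
  exact sum_map_equiv' fun j => d.comm_sq j hT hpl
where
  /-- termwise equivalence of `ofFn` sums [folklore] -/
  sum_map_equiv' {n : ℕ} {f g : Fin n → Sym V} (h : ∀ j, f j ≈ g j) :
      Sym.sum (List.ofFn (f ∘ fun j => j)) ≈ Sym.sum (List.ofFn g) := by
    rw [List.ofFn_eq_map, List.ofFn_eq_map]
    exact sum_map_equiv fun j _ => h j

/-- **Lemma C** (Taylor (1.36), (1.38)): for plain certified `T`,
`|⟨G, [P, T] u⟩| ≤ ‖G‖_{ord T} · C (∑_j ‖X_j u‖₀ + ‖u‖₀)` for `G, u ∈ Nice`, where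
`[P, T] u = P (T u) - T (P u)`. [folklore] -/
theorem lemmaC {T : Sym V} (hT : Cert T) (hpl : Plain T) :
    ∃ C : ℝ, 0 ≤ C ∧ ∀ G u : V → ℂ, Nice G → Nice u →
      ‖pairing G ((Sym.comm d.opP T).apply u)‖ ≤
        rn (ord T) G * (C * (∑ j, rn 0 ((d.Xs j).apply u) + rn 0 u)) := by
  set τ : ℝ := ord T with hτ
  have hl0 : lev T ≤ 1 := by simp [hpl.lev_eq]
  -- constants for the four kinds of terms
  have hfcj : ∀ j, Cert (fcomm (d.X j) T) := fun j => (d.certF j).fcomm_cert (d.isField j) hT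
  have hffj : ∀ j, Cert (fcomm (d.X j) (fcomm (d.X j) T)) := fun j =>
    (d.certF j).fcomm_cert (d.isField j) (hfcj j)
  choose A hA0 hA using fun j => (hfcj j).rn_le (t := 0) (t' := -τ)
    (by have := ord_fcomm_le (d.isField j) (d.ne j) T; linarith)
  choose B hB0 hB using fun j => (hffj j).rn_le (t := 0) (t' := -τ)
    (by have := (comm_comm_fcomm (d.isField j) (d.certF j) (d.ne j) hpl hT).2; linarith)
  obtain ⟨A₀, hA₀0, hA₀⟩ := (d.certF0.fcomm_cert d.isField0 hT).rn_le (t := 0) (t' := -τ)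
    (by have := ord_fcomm_le d.isField0 d.ne0 T; linarith)
  obtain ⟨B₀, hB₀0, hB₀⟩ := (d.certC.ccomm_cert d.isCoefC hT).rn_le (t := 0) (t' := -τ)
    (by have := ord_ccomm_le d.isCoefC T; linarith)
  refine ⟨(∑ j, (2 * A j + B j)) + A₀ + B₀,
    add_nonneg (add_nonneg (Finset.sum_nonneg fun j _ => by
      have := hA0 j; have := hB0 j; positivity) hA₀0) hB₀0, fun G u hG hu => ?_⟩
  -- rewrite `[P,T] u` by the expansion
  rw [d.comm_opP hT hpl u hu]
  unfold commP
  have hcl : ∀ s ∈ List.ofFn (fun j : Fin d.J =>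
      add (smul 2 (comp (fcomm (d.X j) T) (d.Xs j))) (fcomm (d.X j) (fcomm (d.X j) T))), Cert s := by
    intro s hs
    obtain ⟨j, rfl⟩ := List.mem_ofFn.1 hs
    exact ⟨⟨hfcj j, d.cert_Xs j⟩, hffj j⟩
  have hN1 : Nice ((Sym.sum (List.ofFn fun j : Fin d.J =>
      add (smul 2 (comp (fcomm (d.X j) T) (d.Xs j))) (fcomm (d.X j) (fcomm (d.X j) T)))).apply u) :=
    (cert_sum hcl).nice_apply hu
  have hN2 : Nice ((fcomm d.X0 T).apply u) := (d.certF0.fcomm_cert d.isField0 hT).nice_apply hu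
  have hN3 : Nice ((ccomm d.C T).apply u) := (d.certC.ccomm_cert d.isCoefC hT).nice_apply hu
  rw [apply_add, apply_add, pairing_add_right (hG.inH τ) ((hN1.add hN2).inH (-τ)) (hN3.inH (-τ)),
    pairing_add_right (hG.inH τ) (hN1.inH (-τ)) (hN2.inH (-τ)),
    pairing_sum_apply_right hcl hu hG, List.map_ofFn, Fin.sum_ofFn]
  -- termwise bounds
  have hGn := rn_nonneg τ G
  have hterm : ∀ j, ‖pairing G ((add (smul 2 (comp (fcomm (d.X j) T) (d.Xs j)))
      (fcomm (d.X j) (fcomm (d.X j) T))).apply u)‖ ≤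
      rn τ G * ((2 * A j + B j) * (rn 0 ((d.Xs j).apply u) + rn 0 u)) := by
    intro j
    have hXu : Nice ((d.Xs j).apply u) := (d.cert_Xs j).nice_apply hu
    have hn1 : Nice ((fcomm (d.X j) T).apply ((d.Xs j).apply u)) := (hfcj j).nice_apply hXu
    have hn2 : Nice ((fcomm (d.X j) (fcomm (d.X j) T)).apply u) := (hffj j).nice_apply hu
    rw [apply_add, apply_smul, apply_comp,
      pairing_add_right (hG.inH τ) ((hn1.const_mul 2).inH (-τ)) (hn2.inH (-τ)),
      pairing_const_mul_right]
    have b₁ := (norm_pairing_le_rn τ hG hn1).trans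
      (mul_le_mul_of_nonneg_left (hA j _ hXu) hGn)
    have b₂ := (norm_pairing_le_rn τ hG hn2).trans (mul_le_mul_of_nonneg_left (hB j _ hu) hGn)
    have h2 : ‖(starRingEnd ℂ) (2 : ℂ)‖ = 2 := by simp
    calc _ ≤ ‖(starRingEnd ℂ) 2 * pairing G ((fcomm (d.X j) T).apply ((d.Xs j).apply u))‖ +
          ‖pairing G ((fcomm (d.X j) (fcomm (d.X j) T)).apply u)‖ := norm_add_le _ _
      _ = 2 * ‖pairing G ((fcomm (d.X j) T).apply ((d.Xs j).apply u))‖ +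
          ‖pairing G ((fcomm (d.X j) (fcomm (d.X j) T)).apply u)‖ := by rw [norm_mul, h2]
      _ ≤ 2 * (rn τ G * (A j * rn 0 ((d.Xs j).apply u))) + rn τ G * (B j * rn 0 u) :=
          add_le_add (mul_le_mul_of_nonneg_left b₁ zero_le_two) b₂
      _ ≤ _ := by
          have := rn_nonneg 0 ((d.Xs j).apply u); have := rn_nonneg 0 u
          have := hA0 j; have := hB0 j
          have h0 : 0 ≤ rn τ G * (2 * A j * rn 0 u + B j * rn 0 ((d.Xs j).apply u)) := by
            positivity
          nlinarith [h0]
  have bsum : ‖∑ j, pairing G ((add (smul 2 (comp (fcomm (d.X j) T) (d.Xs j)))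
      (fcomm (d.X j) (fcomm (d.X j) T))).apply u)‖ ≤
      ∑ j, rn τ G * ((2 * A j + B j) * (rn 0 ((d.Xs j).apply u) + rn 0 u)) :=
    (norm_sum_le _ _).trans (Finset.sum_le_sum fun j _ => hterm j)
  have b₀ := (norm_pairing_le_rn τ hG hN2).trans (mul_le_mul_of_nonneg_left (hA₀ _ hu) hGn)
  have bC := (norm_pairing_le_rn τ hG hN3).trans (mul_le_mul_of_nonneg_left (hB₀ _ hu) hGn)
  -- collect
  have hsumX : ∀ j, rn 0 ((d.Xs j).apply u) ≤ ∑ i, rn 0 ((d.Xs i).apply u) := fun j =>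
    Finset.single_le_sum (f := fun i => rn 0 ((d.Xs i).apply u)) (fun _ _ => rn_nonneg _ _)
      (Finset.mem_univ j)
  have hun := rn_nonneg 0 u
  have hSX := Finset.sum_nonneg fun i (_ : i ∈ Finset.univ) => rn_nonneg 0 ((d.Xs i).apply u)
  calc _ ≤ ‖∑ j, pairing G ((add (smul 2 (comp (fcomm (d.X j) T) (d.Xs j)))
          (fcomm (d.X j) (fcomm (d.X j) T))).apply u)‖ + ‖pairing G ((fcomm d.X0 T).apply u)‖ +
          ‖pairing G ((ccomm d.C T).apply u)‖ :=
        (norm_add_le _ _).trans (add_le_add (norm_add_le _ _) le_rfl)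
    _ ≤ (∑ j, rn τ G * ((2 * A j + B j) * (rn 0 ((d.Xs j).apply u) + rn 0 u))) +
          rn τ G * (A₀ * rn 0 u) + rn τ G * (B₀ * rn 0 u) := add_le_add (add_le_add bsum b₀) bC
    _ ≤ (∑ j, rn τ G * ((2 * A j + B j) * ((∑ i, rn 0 ((d.Xs i).apply u)) + rn 0 u))) +
          rn τ G * (A₀ * rn 0 u) + rn τ G * (B₀ * rn 0 u) := by
        refine add_le_add (add_le_add (Finset.sum_le_sum fun j _ => ?_) le_rfl) le_rfl
        have := hA0 j; have := hB0 j
        exact mul_le_mul_of_nonneg_left (mul_le_mul_of_nonneg_left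
          (add_le_add (hsumX j) le_rfl) (by positivity)) hGn
    _ = rn τ G * (((∑ j, (2 * A j + B j)) * ((∑ i, rn 0 ((d.Xs i).apply u)) + rn 0 u)) +
          A₀ * rn 0 u + B₀ * rn 0 u) := by
        rw [← Finset.mul_sum, Finset.sum_mul]; ring
    _ ≤ rn τ G * (((∑ j, (2 * A j + B j)) + A₀ + B₀) *
          ((∑ j, rn 0 ((d.Xs j).apply u)) + rn 0 u)) := by
        refine mul_le_mul_of_nonneg_left ?_ hGn
        have hS : 0 ≤ ∑ j, (2 * A j + B j) :=
          Finset.sum_nonneg fun j _ => by have := hA0 j; have := hB0 j; positivity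
        nlinarith [mul_nonneg (add_nonneg hA₀0 hB₀0) hSX, mul_nonneg hS hun]

/-- Lemma C with the commutator on the left of the pairing. [folklore] -/
theorem lemmaC' {T : Sym V} (hT : Cert T) (hpl : Plain T) :
    ∃ C : ℝ, 0 ≤ C ∧ ∀ G u : V → ℂ, Nice G → Nice u →
      ‖pairing ((Sym.comm d.opP T).apply u) G‖ ≤
        rn (ord T) G * (C * (∑ j, rn 0 ((d.Xs j).apply u) + rn 0 u)) := by
  obtain ⟨C, hC, h⟩ := d.lemmaC hT hpl
  refine ⟨C, hC, fun G u hG hu => ?_⟩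
  rw [pairing_comm, Complex.norm_conj]
  exact h G u hG hu

/-! ### The base case `S(X_j, 1)` and the `X_j`-step -/

/-- **Base case** `S(X_j, 1)`: `‖X_j u‖₀ ≤ C (‖P u‖₀ + ‖u‖₀)` (the energy inequality).
[folklore] -/
theorem kohnS_X (j : Fin d.J) : d.KohnS (d.X j) 1 := by
  obtain ⟨K, hK, h⟩ := d.rn_Xs_le
  refine ⟨max K 1, by positivity, fun u hu => ?_⟩
  rw [show (1 : ℝ) - 1 = 0 by norm_num]
  have h1 := h j u hu
  have := rn_nonneg 0 (d.opP.apply u); have := rn_nonneg 0 u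
  have hK1 : K ≤ max K 1 := le_max_left _ _
  have h11 : (1 : ℝ) ≤ max K 1 := le_max_right _ _
  nlinarith [mul_nonneg (sub_nonneg.2 h11) (rn_nonneg 0 (d.opP.apply u)),
    mul_nonneg (sub_nonneg.2 hK1) (rn_nonneg 0 u)]

/-- The sum `∑_j ‖X_j u‖₀` is controlled by `‖P u‖₀ + ‖u‖₀`. [folklore] -/
theorem sum_rn_Xs_le : ∃ K : ℝ, 0 ≤ K ∧ ∀ u : V → ℂ, Nice u →
    (∑ j, rn 0 ((d.Xs j).apply u)) ≤ K * (rn 0 (d.opP.apply u) + rn 0 u) := by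
  obtain ⟨K, hK, h⟩ := d.rn_Xs_le
  refine ⟨d.J * max K 1, by positivity, fun u hu => ?_⟩
  have := rn_nonneg 0 (d.opP.apply u); have := rn_nonneg 0 u
  calc (∑ j, rn 0 ((d.Xs j).apply u)) ≤ ∑ _j : Fin d.J, max K 1 * (rn 0 (d.opP.apply u) + rn 0 u) :=
        Finset.sum_le_sum fun j _ => by
          have h1 := h j u hu
          have hK1 : K ≤ max K 1 := le_max_left _ _
          have h11 : (1 : ℝ) ≤ max K 1 := le_max_right _ _
          nlinarith [mul_nonneg (sub_nonneg.2 h11) (rn_nonneg 0 (d.opP.apply u)),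
            mul_nonneg (sub_nonneg.2 hK1) (rn_nonneg 0 u)]
    _ = d.J * max K 1 * (rn 0 (d.opP.apply u) + rn 0 u) := by
        rw [Finset.sum_const, Finset.card_univ, Fintype.card_fin, nsmul_eq_mul]; ring

/-- **The `X_j`-step** (Taylor (1.32)): `S(F', ε')` with `0 < ε' ≤ 1` implies
`S([X_j, F'], ε'/2)`. [folklore] -/
theorem stepJ (j : Fin d.J) {F' : Field V} (hF : IsField F') (hcF : CertF F') (hr : IsReal F')
    (hne : F' ≠ []) {ε' : ℝ} (_hε' : 0 < ε') (hε'1 : ε' ≤ 1) (IH : d.KohnS F' ε') :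
    d.KohnS (bracket (d.X j) F') (ε' / 2) := by
  set ε : ℝ := ε' / 2 with hε
  set F : Field V := bracket (d.X j) F' with hFdef
  have hX := d.isField j
  have hcX := d.certF j
  have hFi : IsField F := hX.bracket hF
  have hcFb : CertF F := hcX.bracket hX hF hcF
  have hcFs := hcFb.cert_toSym
  -- `T = Λ^{2ε-2} F`
  set T : Sym V := comp (bessel (2 * ε - 2)) (toSym F) with hT
  have hcT : Cert T := ⟨trivial, hcFs⟩
  have hplT : Plain T := ⟨trivial, hFi.plain_toSym⟩
  have hlT : lev T ≤ 1 := by simp [hplT.lev_eq]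
  have hordT : ord T ≤ 2 * ε - 1 := by
    have := hFi.ord_toSym_le; simp only [hT, ord_comp, ord_bessel]; linarith
  have hσ0 : 2 * ε - 1 ≤ 0 := by rw [hε]; linarith
  obtain ⟨CA, hCA, hA⟩ := lemmaA hX hcX (d.isReal j) (d.ne j) hcT hlT hordT
  obtain ⟨CB, hCB, hB⟩ := lemmaB hF hcF hr hne hcT hlT hordT hσ0
  obtain ⟨CI, hCI, hI⟩ := IH
  obtain ⟨K, hK, hKx⟩ := d.rn_Xs_le
  refine ⟨Real.sqrt (CA + CB) * (CI + K + 2), by positivity, fun u hu => ?_⟩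
  have hFu : Nice ((toSym F').apply u) := hcF.cert_toSym.nice_apply hu
  have hXu : Nice ((d.Xs j).apply u) := (d.cert_Xs j).nice_apply hu
  have hFbu : Nice ((toSym F).apply u) := hcFs.nice_apply hu
  -- `F u = X (F' u) - F' (X u)`
  have hbr := comm_toSym hX hcX hF hcF u hu
  rw [apply_comm] at hbr
  -- the identity (1.30)
  have hid : rn (ε - 1) ((toSym F).apply u) ^ 2 =
      (pairing ((d.Xs j).apply ((toSym F').apply u)) (T.apply u)).re -
        (pairing ((toSym F').apply ((d.Xs j).apply u)) (T.apply u)).re := by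
    rw [rn_sq_eq_re_pairing hFbu ε, ← Complex.sub_re, ← pairing_sub_left
      (((d.cert_Xs j).nice_apply hFu).inH 0) ((hcF.cert_toSym.nice_apply hXu).inH 0)
      (by simpa using (hcT.nice_apply hu).inH 0)]
    have hTu' : (Sym.bessel (2 * ε - 2)).apply ((toSym F).apply u) = T.apply u := rfl
    have hFu' : (toSym F).apply u =
        fun ξ => (d.Xs j).apply ((toSym F').apply u) ξ - (toSym F').apply ((d.Xs j).apply u) ξ := by
      rw [hFdef, ← hbr]
    rw [hTu', hFu']
  -- the two bounds
  have bA := hA ((toSym F').apply u) u hFu hu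
  have bB := hB ((d.Xs j).apply u) u hXu hu
  -- numbers
  set y := rn (ε - 1) ((toSym F).apply u) with hy
  set f := rn (2 * ε - 1) ((toSym F').apply u) with hf
  set x := rn 0 ((d.Xs j).apply u) with hx
  set p := rn 0 (d.opP.apply u) with hp
  set n := rn 0 u with hn
  have hy0 : 0 ≤ y := rn_nonneg _ _
  have hf0 : 0 ≤ f := rn_nonneg _ _
  have hx0 : 0 ≤ x := rn_nonneg _ _
  have hp0 : 0 ≤ p := rn_nonneg _ _
  have hn0 : 0 ≤ n := rn_nonneg _ _
  have hfI : f ≤ CI * (p + n) := by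
    have := hI u hu; rwa [show ε' - 1 = 2 * ε - 1 by rw [hε]; ring] at this
  have hxK : x ≤ p + K * n := hKx j u hu
  have hy2 : y ^ 2 ≤ f * (CA * (x + n)) + x * (CB * (f + n)) := by
    rw [hid]
    have h1 := (abs_re_le_norm _).trans bA
    have h2 := (abs_re_le_norm _).trans bB
    have := le_abs_self (pairing ((d.Xs j).apply ((toSym F').apply u)) (T.apply u)).re
    have := neg_abs_le (pairing ((toSym F').apply ((d.Xs j).apply u)) (T.apply u)).re
    linarith
  -- `y² ≤ (CA + CB) (f + x + n)²`
  have e1 : f * (x + n) ≤ (f + x + n) ^ 2 := by nlinarith [mul_nonneg hf0 hx0, mul_nonneg hf0 hn0]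
  have e2 : x * (f + n) ≤ (f + x + n) ^ 2 := by nlinarith [mul_nonneg hf0 hx0, mul_nonneg hx0 hn0]
  have hy3 : y ^ 2 ≤ (CA + CB) * (f + x + n) ^ 2 := by
    have := mul_le_mul_of_nonneg_left e1 hCA
    have := mul_le_mul_of_nonneg_left e2 hCB
    nlinarith
  have hy4 : y ≤ Real.sqrt (CA + CB) * (f + x + n) :=
    le_sqrt_mul_of_sq_le hy0 (by positivity) (by positivity) hy3
  have hfx : f + x + n ≤ (CI + K + 2) * (p + n) := by
    have e : (CI + K + 2) * (p + n) = CI * (p + n) + (p + K * n) + (K * p + p + 2 * n) := by ring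
    rw [e]
    nlinarith [mul_nonneg hK hp0]
  calc y ≤ Real.sqrt (CA + CB) * (f + x + n) := hy4
    _ ≤ Real.sqrt (CA + CB) * ((CI + K + 2) * (p + n)) :=
        mul_le_mul_of_nonneg_left hfx (Real.sqrt_nonneg _)
    _ = Real.sqrt (CA + CB) * (CI + K + 2) * (p + n) := by ring

end HData

end Literature.Analysis.Hypoelliptic
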